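import Summits.Ventures.LatticeQCDFlow.Scaling.SimulatedTemperingDiffusive
import Summits.Ventures.LatticeQCDFlow.Scaling.ParallelTemperingDiffusive
import Summits.Ventures.LatticeQCDFlow.Scoring.ReversibleKernelTauIntFloor

/-!
HONEST FRAMING: exact (Metropolis-corrected) sampling algorithms for lattice gauge theory; figures
of merit are autocorrelation/cost numbers at stated couplings and volumes; no continuum-physics
claim.

# TemperingLevelTauInt — FROM LAG ONE TO `τ_int`: FOR EVERY REVERSIBLE EXACT TEMPERING KERNEL (SIMULATED
# TEMPERING; REPLICA EXCHANGE / PTBC WITH A TAGGED REPLICA) THE LEVEL HAS `τ_int ≥ K(K+2)/(6ā_K) − ½`, AND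
# `τ_int ≥ e·m·(b−a)²/96 − ½` (resp. `/48`) FOR EVERY NUMBER OF LEVELS (lean-2 GEN-13, ours)

Venture-side (OURS).  Cell `lqcd-flow` (pub-lqcd), unit `pub-lqcd-lean-2-g13`, 2026-08-23.  The level laws of
`Scaling/SimulatedTemperingDiffusive` and `Scaling/ParallelTemperingDiffusive` bound the LAG-ONE autocorrelation
of the level.  Row 8's kernel-level Madras–Slade floor (`Scoring/ReversibleKernelTauIntFloor.tauInt_ge_of_isReversible`:
for every `π`-REVERSIBLE Markov kernel and bounded observable with a summable autocorrelation series and `ρ(1) < 1`,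
`τ_int ≥ (1 + ρ(1))/(2(1 − ρ(1))) = 1/(1 − ρ(1)) − ½`) turns them into floors on the cell's figure of merit
`Scoring.tauInt` of the CENTRED level `k − K/2` — for every reversible implementation (Metropolis level / swap
moves, heat-bath or palindromic within-level sweeps, random-scan mixtures of such).

## What is proved

* §1 `tauInt_ge_inv_of_lagOne_ge` — reversible `κ`, bounded measurable `g`, summable series, `ρ(1) < 1`,
  `1 − ε ≤ ρ(1)`: `1/ε − ½ ≤ τ_int` (`ε > 0` follows); `sum_range_succ_centred_sq`, `centredLevel_measurable_abs_le`, `level_centred_sq_mean_eq`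
  (`E_π[(k − K/2)²] = K(K+2)/12` for equally visited levels), **`level_centred_lagOne_ge`** — the movement bound of
  `Scaling/LevelAutocorrelationFloor` for the centred level: `autocov₁ ≥ K(K+2)/12 − ā/2`, so
  `ρ(1) ≥ 1 − 6ā/(K(K+2))` in row 8's normalisation `autocov₁/autocov₀`.
* §2 **`st_level_tauInt_ge`** — SIMULATED TEMPERING (`stTarget`, exact weights; `κ` reversible, target-invariant,
  nearest-neighbour level moves with `κ(z,{level ≠ level z}) ≤ stLevelMoveRatio z`; summable series, `ρ(1) < 1`):
  `K(K+2)/(6ā_K) − ½ ≤ τ_int(k − K/2)`, `ā_K = (2/(K+1))Σ_{k<K}∫min(p_{β_k},p_{β_{k+1}})dμ`;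
  **`st_level_tauInt_ge_kfree`** — uniform ladder `a < b`, floor `0 < m ≤ Var_{μ_u}(X)` on `[a,b]`:
  `e·m·(b−a)²/96 − ½ ≤ τ_int` for EVERY `K ≥ 1`.
* §3 **`pt_level_tauInt_ge`**, **`pt_level_tauInt_ge_kfree`** — REPLICA EXCHANGE with a tagged replica
  (`ptTaggedTarget`; rate `≤ ptSwapRatio`): `K(K+2)/(6ā_K) − ½ ≤ τ_int`, `ā_K = (2/(K+1))Σ_j swapAcc(β_j,β_{j+1})`,
  and `e·m·(b−a)²/48 − ½ ≤ τ_int` for every `K ≥ 1`.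

Reading (no numerics implied): for reversible exact tempering the integrated autocorrelation time of the replica
index is at least of order `m·(b−a)²` (smallest heat capacity on the window × window², extensive in the volume;
`#D·Δc²` for PTBC's boundary-condition ladder), whatever the number of levels and the within-level algorithm; the
Wilson / defect / 2-d / strong-coupling floors of the companion files substitute for `m` verbatim.  NOT CLAIMED:
non-reversible implementations (their lag-one law stands); summability and `ρ(1) < 1` are hypotheses (a
non-summable series reads `τ_int = ∞` physically, `½` in Lean's `tsum` convention); round trips as stopping
times.  Literature grade (cell rule): KNOWN MECHANISM (Madras–Slade 1993 Prop. 9.2.2; diffusive tempering), NEW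
TYPING; nothing cited as a fact.
-/

noncomputable section

open MeasureTheory ProbabilityTheory Set Filter Finset
open Summit.Ventures.LatticeQCDFlow.Scoring

namespace Summit.Ventures.LatticeQCDFlow.Scaling

/-! ## §1 From a lag-one floor to a `τ_int` floor (reversible kernels); the centred level -/

section General

variable {E : Type*} [MeasurableSpace E] {κ : Kernel E E} [IsMarkovKernel κ] {π : Measure E}
  [IsProbabilityMeasure π]

/-- **`ρ(1) ≥ 1 − ε` ⇒ `τ_int ≥ 1/ε − ½` for a reversible kernel** (bounded measurable `g`, summable
autocorrelation series, `ρ(1) < 1`; row 8's Madras–Slade floor `τ_int ≥ (1+ρ(1))/(2(1−ρ(1)))`). [ours] -/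
theorem tauInt_ge_inv_of_lagOne_ge (hrev : Kernel.IsReversible κ π) {g : E → ℝ} (hg : Measurable g) {B : ℝ}
    (hB : ∀ x, |g x| ≤ B) (hs : Summable fun t => autocov κ π g (t + 1) / autocov κ π g 0)
    (hρ : autocov κ π g 1 / autocov κ π g 0 < 1) {ε : ℝ} (hε : 1 - ε ≤ autocov κ π g 1 / autocov κ π g 0) :
    1 / ε - 1 / 2 ≤ tauInt (fun t => autocov κ π g t / autocov κ π g 0) := by
  have h := tauInt_ge_of_isReversible hrev hg hB hs hρ
  set x := autocov κ π g 1 / autocov κ π g 0 with hx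
  have h1x : 0 < 1 - x := sub_pos.2 hρ
  have hεpos : 1 - x ≤ ε := by linarith
  have hinv : 1 / ε ≤ 1 / (1 - x) := one_div_le_one_div_of_le h1x hεpos
  have e : (1 + x) / (2 * (1 - x)) = 1 / (1 - x) - 1 / 2 := by field_simp; ring
  rw [e] at h; linarith

/-- `Σ_{k ≤ K} (k − K/2)² = K(K+1)(K+2)/12` over `ℝ`. [folklore] -/
theorem sum_range_succ_centred_sq (K : ℕ) :
    ∑ k ∈ range (K + 1), ((k : ℝ) - K / 2) ^ 2 = (K : ℝ) * (K + 1) * (K + 2) / 12 := by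
  have hpow : ∀ n : ℕ, (∑ k ∈ range (n + 1), (k : ℝ) ^ 2 = (n : ℝ) * (n + 1) * (2 * n + 1) / 6) ∧
      (∑ k ∈ range (n + 1), (k : ℝ) = (n : ℝ) * (n + 1) / 2) := by
    intro n
    induction n with
    | zero => simp
    | succ n ih =>
      obtain ⟨ih2, ih1⟩ := ih
      refine ⟨?_, ?_⟩
      · rw [Finset.sum_range_succ, ih2]; push_cast; ring
      · rw [Finset.sum_range_succ, ih1]; push_cast; ring
  obtain ⟨h2, h1⟩ := hpow K
  have e : ∀ k : ℕ, ((k : ℝ) - K / 2) ^ 2 = (k : ℝ) ^ 2 - K * (k : ℝ) + (K : ℝ) ^ 2 / 4 := fun k => by ring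
  simp only [e, Finset.sum_add_distrib, Finset.sum_sub_distrib, ← Finset.mul_sum, Finset.sum_const,
    Finset.card_range, nsmul_eq_mul, h1, h2]
  push_cast
  ring

variable {lev : E → ℕ} {K : ℕ}

/-- **`E_π[(k − K/2)²] = K(K+2)/12`** for equally visited levels `0, …, K`. [ours] -/
theorem level_centred_sq_mean_eq (hlev : Measurable lev) (hK : ∀ x, lev x ≤ K)
    (hunif : ∀ k, k ≤ K → π.real {x | lev x = k} = 1 / (K + 1)) :
    ∫ x, (((lev x : ℕ) : ℝ) - K / 2) ^ 2 ∂π = (K : ℝ) * (K + 2) / 12 := by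
  rw [integral_comp_level_eq hlev hK hunif (fun k => ((k : ℝ) - K / 2) ^ 2), sum_range_succ_centred_sq]
  have : (K : ℝ) + 1 ≠ 0 := by positivity
  field_simp

/-- The centred level `k − K/2` is measurable and bounded by `K`. [folklore] -/
theorem centredLevel_measurable_abs_le (hlev : Measurable lev) (hK : ∀ x, lev x ≤ K) :
    Measurable (fun x => ((lev x : ℕ) : ℝ) - K / 2) ∧ ∀ x, |((lev x : ℕ) : ℝ) - K / 2| ≤ K := by
  refine ⟨(measurable_from_nat.comp hlev).sub_const _, fun x => ?_⟩
  have h0 : (0 : ℝ) ≤ lev x := Nat.cast_nonneg _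
  have h1 : ((lev x : ℕ) : ℝ) ≤ K := by exact_mod_cast hK x
  rw [abs_le]; constructor <;> linarith

/-- **THE CENTRED LEVEL'S LAG-ONE FLOOR** (the movement bound of `LevelAutocorrelationFloor` for `g = k − K/2`):
`K(K+2)/12 − ā/2 ≤ autocov κ π g 1`, with `autocov κ π g 0 = K(K+2)/12`. [ours] -/
theorem level_centred_lagOne_ge (hπ : Kernel.Invariant κ π) (hlev : Measurable lev) (hK : ∀ x, lev x ≤ K)
    (hunif : ∀ k, k ≤ K → π.real {x | lev x = k} = 1 / (K + 1))
    (hnn : ∀ x, ∀ᵐ y ∂(κ x), |((lev y : ℕ) : ℝ) - lev x| ≤ 1)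
    {r : E → ℝ} (hrm : Measurable r) {R : ℝ} (hr0 : ∀ x, 0 ≤ r x) (hrR : ∀ x, r x ≤ R)
    (hrate : ∀ x, (κ x).real {y | lev y ≠ lev x} ≤ r x) :
    autocov κ π (fun x => ((lev x : ℕ) : ℝ) - K / 2) 0 = (K : ℝ) * (K + 2) / 12 ∧
      K * (K + 2) / 12 - 1 / 2 * ∫ x, r x ∂π ≤ autocov κ π (fun x => ((lev x : ℕ) : ℝ) - K / 2) 1 := by
  obtain ⟨hfm, hfb⟩ := centredLevel_measurable_abs_le (lev := lev) hlev hK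
  have hmove : ∀ x, ∀ᵐ y ∂(κ x), |(((lev y : ℕ) : ℝ) - K / 2) - (((lev x : ℕ) : ℝ) - K / 2)| ≤ 1 := fun x => by
    filter_upwards [hnn x] with y hy
    have e : (((lev y : ℕ) : ℝ) - K / 2) - (((lev x : ℕ) : ℝ) - K / 2) = ((lev y : ℕ) : ℝ) - lev x := by ring
    rw [e]; exact hy
  have hrate' : ∀ x, (κ x).real {y | (((lev y : ℕ) : ℝ) - K / 2) ≠ (((lev x : ℕ) : ℝ) - K / 2)} ≤ r x := fun x => by
    have e : {y | (((lev y : ℕ) : ℝ) - K / 2) ≠ (((lev x : ℕ) : ℝ) - K / 2)} = {y | lev y ≠ lev x} := by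
      ext y; simp only [Set.mem_setOf_eq, ne_eq, sub_left_inj, Nat.cast_inj]
    rw [e]; exact hrate x
  have h := sq_integral_sub_autocov_le hπ hfm hfb hmove hrm hr0 hrR hrate'
  have h0 : autocov κ π (fun x => ((lev x : ℕ) : ℝ) - K / 2) 0 = (K : ℝ) * (K + 2) / 12 := by
    simp only [autocov, Function.iterate_zero, id_eq, ← sq]
    exact level_centred_sq_mean_eq hlev hK hunif
  have h2 : ∫ x, (((lev x : ℕ) : ℝ) - K / 2) ^ 2 ∂π = (K : ℝ) * (K + 2) / 12 := level_centred_sq_mean_eq hlev hK hunif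
  refine ⟨h0, ?_⟩
  simp only [one_pow] at h
  linarith

/-- **`τ_int` OF THE LEVEL, GENERAL FORM**: reversible `κ`, equally visited levels `0, …, K` (`K ≥ 1`),
nearest-neighbour level moves with probability `≤ r`, `ā = ∫ r dπ`; if the autocorrelation series of the centred
level `g = k − K/2` is summable with `ρ(1) < 1`, then `K(K+2)/(6ā) − ½ ≤ τ_int(g)`. [ours] -/
theorem level_tauInt_ge (hrev : Kernel.IsReversible κ π) (hπ : Kernel.Invariant κ π) (hlev : Measurable lev)
    (hK : ∀ x, lev x ≤ K) (hK1 : 1 ≤ K) (hunif : ∀ k, k ≤ K → π.real {x | lev x = k} = 1 / (K + 1))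
    (hnn : ∀ x, ∀ᵐ y ∂(κ x), |((lev y : ℕ) : ℝ) - lev x| ≤ 1)
    {r : E → ℝ} (hrm : Measurable r) {R : ℝ} (hr0 : ∀ x, 0 ≤ r x) (hrR : ∀ x, r x ≤ R)
    (hrate : ∀ x, (κ x).real {y | lev y ≠ lev x} ≤ r x)
    (hs : Summable fun t => autocov κ π (fun x => ((lev x : ℕ) : ℝ) - K / 2) (t + 1) /
      autocov κ π (fun x => ((lev x : ℕ) : ℝ) - K / 2) 0)
    (hρ : autocov κ π (fun x => ((lev x : ℕ) : ℝ) - K / 2) 1 /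
      autocov κ π (fun x => ((lev x : ℕ) : ℝ) - K / 2) 0 < 1) :
    K * (K + 2) / (6 * ∫ x, r x ∂π) - 1 / 2 ≤
      tauInt (fun t => autocov κ π (fun x => ((lev x : ℕ) : ℝ) - K / 2) t /
        autocov κ π (fun x => ((lev x : ℕ) : ℝ) - K / 2) 0) := by
  obtain ⟨h0, h1⟩ := level_centred_lagOne_ge hπ hlev hK hunif hnn hrm hr0 hrR hrate
  obtain ⟨hfm, hfb⟩ := centredLevel_measurable_abs_le (lev := lev) hlev hK
  have hK1' : (1 : ℝ) ≤ K := by exact_mod_cast hK1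
  have hV : (0 : ℝ) < K * (K + 2) / 12 := by positivity
  -- `ρ(1) ≥ 1 − ε`, `ε = 6ā/(K(K+2))`
  have hε : 1 - 6 * (∫ x, r x ∂π) / (K * (K + 2)) ≤
      autocov κ π (fun x => ((lev x : ℕ) : ℝ) - K / 2) 1 / autocov κ π (fun x => ((lev x : ℕ) : ℝ) - K / 2) 0 := by
    rw [h0, le_div_iff₀ hV, sub_mul, one_mul, div_mul_eq_mul_div]
    have e : 6 * (∫ x, r x ∂π) * (↑K * (↑K + 2) / 12) / (↑K * (↑K + 2)) = 1 / 2 * ∫ x, r x ∂π := by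
      field_simp; ring
    rw [e]; linarith
  have h := tauInt_ge_inv_of_lagOne_ge hrev hfm hfb hs hρ hε
  rwa [one_div_div] at h

end General

/-! ## §2 Simulated tempering -/

section ST

variable {Ω : Type*} [MeasurableSpace Ω] {X : Ω → ℝ} {μ : Measure Ω} [IsProbabilityMeasure μ]
  {β : ℕ → ℝ} {K : ℕ}

/-- **`τ_int` OF THE LEVEL OF A REVERSIBLE EXACT SIMULATED-TEMPERING KERNEL**: `κ` reversible for and leaving
invariant `stTarget X μ β K`, nearest-neighbour level moves with `κ(z, {level ≠ level z}) ≤ stLevelMoveRatio z`,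
`K ≥ 1`; summable series and `ρ(1) < 1` for the centred level: `K(K+2)/(6ā_K) − ½ ≤ τ_int`,
`ā_K = (2/(K+1))·Σ_{k<K} ∫ min(p_{β_k}, p_{β_{k+1}}) dμ`. [ours] -/
theorem st_level_tauInt_ge (hXm : Measurable X) (hXb : ∃ C, ∀ x, |X x| ≤ C) (hK : 1 ≤ K)
    (κ : Kernel (Fin (K + 1) × Ω) (Fin (K + 1) × Ω)) [IsMarkovKernel κ]
    (hrev : Kernel.IsReversible κ (stTarget X μ β K)) (hinv : Kernel.Invariant κ (stTarget X μ β K))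
    (hnn : ∀ z, ∀ᵐ y ∂(κ z), |(((y.1 : Fin (K + 1)) : ℕ) : ℝ) - ((z.1 : Fin (K + 1)) : ℕ)| ≤ 1)
    (hrate : ∀ z, (κ z).real {y | ((y.1 : Fin (K + 1)) : ℕ) ≠ ((z.1 : Fin (K + 1)) : ℕ)} ≤ stLevelMoveRatio X μ β K z)
    (hs : Summable fun t => autocov κ (stTarget X μ β K) (fun z => (((z.1 : Fin (K + 1)) : ℕ) : ℝ) - K / 2) (t + 1) /
      autocov κ (stTarget X μ β K) (fun z => (((z.1 : Fin (K + 1)) : ℕ) : ℝ) - K / 2) 0)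
    (hρ : autocov κ (stTarget X μ β K) (fun z => (((z.1 : Fin (K + 1)) : ℕ) : ℝ) - K / 2) 1 /
      autocov κ (stTarget X μ β K) (fun z => (((z.1 : Fin (K + 1)) : ℕ) : ℝ) - K / 2) 0 < 1) :
    K * (K + 2) / (6 * (2 / (K + 1) * ∑ k ∈ range K, ∫ x, min (Real.exp (β k * X x) / mgf X μ (β k))
        (Real.exp (β (k + 1) * X x) / mgf X μ (β (k + 1))) ∂μ)) - 1 / 2 ≤
      tauInt (fun t => autocov κ (stTarget X μ β K) (fun z => (((z.1 : Fin (K + 1)) : ℕ) : ℝ) - K / 2) t /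
        autocov κ (stTarget X μ β K) (fun z => (((z.1 : Fin (K + 1)) : ℕ) : ℝ) - K / 2) 0) := by
  haveI := isProbabilityMeasure_stTarget (μ := μ) (β := β) (K := K) hXm hXb
  have h := level_tauInt_ge (lev := fun z : Fin (K + 1) × Ω => ((z.1 : Fin (K + 1)) : ℕ)) hrev hinv
    measurable_stLevel (fun z => Nat.le_of_lt_succ z.1.isLt) hK (fun k hk => stTarget_real_level hXm hXb k hk) hnn
    (measurable_stLevelMoveRatio hXm) (R := 2) (stLevelMoveRatio_nonneg hXm hXb) stLevelMoveRatio_le_two hrate hs hρ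
  refine le_trans ?_ h
  have hmove := st_moveRate_le (μ := μ) (β := β) (K := K) hXm hXb
  have hK1 : (1 : ℝ) ≤ K := by exact_mod_cast hK
  have hKpos : (0 : ℝ) < K * (K + 2) := by positivity
  -- monotonicity in the rate: a smaller true rate only increases the floor
  by_cases hI : 0 < ∫ z, stLevelMoveRatio X μ β K z ∂(stTarget X μ β K)
  · exact sub_le_sub_right (div_le_div_of_nonneg_left hKpos.le (by positivity) (by linarith)) _
  · push Not at hI
    have h0 : ∫ z, stLevelMoveRatio X μ β K z ∂(stTarget X μ β K) = 0 :=
      le_antisymm hI (integral_nonneg fun z => stLevelMoveRatio_nonneg hXm hXb z)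
    -- then `1 ≤ ρ(1)` by the centred lag-one floor, contradicting `ρ(1) < 1`
    exfalso
    obtain ⟨e0, e1⟩ := level_centred_lagOne_ge (lev := fun z : Fin (K + 1) × Ω => ((z.1 : Fin (K + 1)) : ℕ))
      hinv measurable_stLevel (fun z => Nat.le_of_lt_succ z.1.isLt) (fun k hk => stTarget_real_level hXm hXb k hk)
      hnn (measurable_stLevelMoveRatio hXm) (R := 2) (stLevelMoveRatio_nonneg hXm hXb) stLevelMoveRatio_le_two hrate
    rw [h0, mul_zero, sub_zero] at e1
    rw [e0, div_lt_one (by positivity)] at hρ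
    linarith

/-- **REVERSIBLE SIMULATED TEMPERING, LADDER-SIZE-FREE**: uniform ladder from `a` to `b > a`, variance floor
`0 < m ≤ Var_{μ_u}(X)` on `[a, b]`, `κ` as in `st_level_tauInt_ge`: `e·m·(b−a)²/96 − ½ ≤ τ_int(level)` for every
`K ≥ 1`. [ours] -/
theorem st_level_tauInt_ge_kfree (hXm : Measurable X) (hXb : ∃ C, ∀ x, |X x| ≤ C) {a b m : ℝ} (hab : a < b)
    (hm0 : 0 < m) (hm : ∀ u ∈ Icc a b, m ≤ variance X (μ.tilted fun x => u * X x)) (hK : 1 ≤ K)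
    (κ : Kernel (Fin (K + 1) × Ω) (Fin (K + 1) × Ω)) [IsMarkovKernel κ]
    (hrev : Kernel.IsReversible κ (stTarget X μ (fun k => a + k * ((b - a) / K)) K))
    (hinv : Kernel.Invariant κ (stTarget X μ (fun k => a + k * ((b - a) / K)) K))
    (hnn : ∀ z, ∀ᵐ y ∂(κ z), |(((y.1 : Fin (K + 1)) : ℕ) : ℝ) - ((z.1 : Fin (K + 1)) : ℕ)| ≤ 1)
    (hrate : ∀ z, (κ z).real {y | ((y.1 : Fin (K + 1)) : ℕ) ≠ ((z.1 : Fin (K + 1)) : ℕ)} ≤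
      stLevelMoveRatio X μ (fun k => a + k * ((b - a) / K)) K z)
    (hs : Summable fun t => autocov κ (stTarget X μ (fun k => a + k * ((b - a) / K)) K)
        (fun z => (((z.1 : Fin (K + 1)) : ℕ) : ℝ) - K / 2) (t + 1) /
      autocov κ (stTarget X μ (fun k => a + k * ((b - a) / K)) K) (fun z => (((z.1 : Fin (K + 1)) : ℕ) : ℝ) - K / 2) 0)
    (hρ : autocov κ (stTarget X μ (fun k => a + k * ((b - a) / K)) K) (fun z => (((z.1 : Fin (K + 1)) : ℕ) : ℝ) - K / 2) 1 /
      autocov κ (stTarget X μ (fun k => a + k * ((b - a) / K)) K) (fun z => (((z.1 : Fin (K + 1)) : ℕ) : ℝ) - K / 2) 0 < 1) :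
    Real.exp 1 * m * (b - a) ^ 2 / 96 - 1 / 2 ≤
      tauInt (fun t => autocov κ (stTarget X μ (fun k => a + k * ((b - a) / K)) K)
          (fun z => (((z.1 : Fin (K + 1)) : ℕ) : ℝ) - K / 2) t /
        autocov κ (stTarget X μ (fun k => a + k * ((b - a) / K)) K) (fun z => (((z.1 : Fin (K + 1)) : ℕ) : ℝ) - K / 2) 0) := by
  haveI := isProbabilityMeasure_stTarget (μ := μ) (β := fun k => a + k * ((b - a) / K)) (K := K) hXm hXb
  -- the lag-one floor in the K-free form `ρ(1) ≥ 1 − 96/(e m (b−a)²)` via the centred level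
  obtain ⟨e0, e1⟩ := level_centred_lagOne_ge (lev := fun z : Fin (K + 1) × Ω => ((z.1 : Fin (K + 1)) : ℕ))
    hinv measurable_stLevel (fun z => Nat.le_of_lt_succ z.1.isLt) (fun k hk => stTarget_real_level hXm hXb k hk)
    hnn (measurable_stLevelMoveRatio hXm) (R := 2) (stLevelMoveRatio_nonneg hXm hXb) stLevelMoveRatio_le_two hrate
  have hmove := st_moveRate_le (μ := μ) (β := fun k => a + k * ((b - a) / K)) (K := K) hXm hXb
  have hlad := st_moveRate_le_ladder (μ := μ) hXm hXb hab.le hK hm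
  have hKr : (1 : ℝ) ≤ K := by exact_mod_cast hK
  have hKpos : (0 : ℝ) < K * (K + 2) := by positivity
  have hba : 0 < (b - a) ^ 2 := by nlinarith
  have hA : 0 < m * (b - a) ^ 2 / 8 := by positivity
  have hkfree := ladder_rate_kfree hA hKr
  have eA : -(m * (b - a) ^ 2 / 8 / (K : ℝ) ^ 2) = -(m * (b - a) ^ 2 / (8 * K ^ 2)) := by rw [div_div]
  rw [eA] at hkfree
  have hsum : (∑ k ∈ range K, ∫ x, min (Real.exp ((fun k : ℕ => a + k * ((b - a) / K)) k * X x) /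
        mgf X μ ((fun k : ℕ => a + k * ((b - a) / K)) k))
      (Real.exp ((fun k : ℕ => a + k * ((b - a) / K)) (k + 1) * X x) /
        mgf X μ ((fun k : ℕ => a + k * ((b - a) / K)) (k + 1))) ∂μ) =
      ∑ k ∈ range K, ∫ x, min (Real.exp ((a + k * ((b - a) / K)) * X x) / mgf X μ (a + k * ((b - a) / K)))
        (Real.exp ((a + (k + 1 : ℕ) * ((b - a) / K)) * X x) / mgf X μ (a + (k + 1 : ℕ) * ((b - a) / K))) ∂μ := by
    refine Finset.sum_congr rfl fun k _ => ?_
    simp only [Nat.cast_add, Nat.cast_one]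
  rw [hsum] at hmove
  -- `∫ rate ≤ ā_K ≤ (2K/(K+1)) e^{−A/K²}` and `6·that/(K(K+2)) ≤ 96/(e m (b−a)²)`
  have hIle : ∫ z, stLevelMoveRatio X μ (fun k => a + k * ((b - a) / K)) K z
      ∂(stTarget X μ (fun k => a + k * ((b - a) / K)) K) ≤
      2 * K / (K + 1) * Real.exp (-(m * (b - a) ^ 2 / (8 * K ^ 2))) := hmove.trans hlad
  have hI : 6 * (∫ z, stLevelMoveRatio X μ (fun k => a + k * ((b - a) / K)) K z
      ∂(stTarget X μ (fun k => a + k * ((b - a) / K)) K)) / (K * (K + 2)) ≤ 96 / (Real.exp 1 * m * (b - a) ^ 2) := by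
    have e2 : 12 / (Real.exp 1 * (m * (b - a) ^ 2 / 8)) = 96 / (Real.exp 1 * m * (b - a) ^ 2) := by field_simp; ring
    calc 6 * (∫ z, stLevelMoveRatio X μ (fun k => a + k * ((b - a) / K)) K z
          ∂(stTarget X μ (fun k => a + k * ((b - a) / K)) K)) / (K * (K + 2))
        ≤ 6 * (2 * K / (K + 1) * Real.exp (-(m * (b - a) ^ 2 / (8 * K ^ 2)))) / (K * (K + 2)) := by gcongr
      _ = 12 * Real.exp (-(m * (b - a) ^ 2 / (8 * K ^ 2))) / ((K + 1) * (K + 2)) := by field_simp; ring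
      _ ≤ 96 / (Real.exp 1 * m * (b - a) ^ 2) := by rw [← e2]; exact hkfree
  have hε : 1 - 96 / (Real.exp 1 * m * (b - a) ^ 2) ≤
      autocov κ (stTarget X μ (fun k => a + k * ((b - a) / K)) K) (fun z => (((z.1 : Fin (K + 1)) : ℕ) : ℝ) - K / 2) 1 /
      autocov κ (stTarget X μ (fun k => a + k * ((b - a) / K)) K) (fun z => (((z.1 : Fin (K + 1)) : ℕ) : ℝ) - K / 2) 0 := by
    rw [e0, le_div_iff₀ (by positivity)]
    have e3 : (1 - 96 / (Real.exp 1 * m * (b - a) ^ 2)) * (↑K * (↑K + 2) / 12) =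
        ↑K * (↑K + 2) / 12 - (96 / (Real.exp 1 * m * (b - a) ^ 2)) * (↑K * (↑K + 2)) / 12 := by ring
    rw [e3]
    have h4 : 1 / 2 * (∫ z, stLevelMoveRatio X μ (fun k => a + k * ((b - a) / K)) K z
        ∂(stTarget X μ (fun k => a + k * ((b - a) / K)) K)) ≤
        (96 / (Real.exp 1 * m * (b - a) ^ 2)) * (↑K * (↑K + 2)) / 12 := by
      have := (div_le_iff₀ hKpos).1 hI
      linarith
    linarith
  obtain ⟨hfm, hfb⟩ := centredLevel_measurable_abs_le (lev := fun z : Fin (K + 1) × Ω =>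
    ((z.1 : Fin (K + 1)) : ℕ)) measurable_stLevel (fun z => Nat.le_of_lt_succ z.1.isLt)
  have h := tauInt_ge_inv_of_lagOne_ge hrev hfm hfb hs hρ hε
  rwa [one_div_div] at h

end ST

/-! ## §3 Replica exchange with a tagged replica -/

section PT

variable {Ω : Type*} [MeasurableSpace Ω] {X : Ω → ℝ} {μ : Measure Ω} [IsProbabilityMeasure μ]
  {β : ℕ → ℝ} {K : ℕ}

/-- **`τ_int` OF THE TAGGED REPLICA'S LEVEL, REVERSIBLE REPLICA EXCHANGE**: `κ` reversible for and leaving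
invariant `ptTaggedTarget X μ β K`, nearest-neighbour tag moves with probability `≤ ptSwapRatio`, `K ≥ 1`; summable
series and `ρ(1) < 1` for the centred tag: `K(K+2)/(6ā_K) − ½ ≤ τ_int`, `ā_K = (2/(K+1))Σ_j swapAcc(β_j,β_{j+1})`.
[ours] -/
theorem pt_level_tauInt_ge (hXm : Measurable X) (hXb : ∃ C, ∀ x, |X x| ≤ C) (hK : 1 ≤ K)
    (κ : Kernel (Fin (K + 1) × (Fin (K + 1) → Ω)) (Fin (K + 1) × (Fin (K + 1) → Ω))) [IsMarkovKernel κ]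
    (hrev : Kernel.IsReversible κ (ptTaggedTarget X μ β K)) (hinv : Kernel.Invariant κ (ptTaggedTarget X μ β K))
    (hnn : ∀ z, ∀ᵐ y ∂(κ z), |(((y.1 : Fin (K + 1)) : ℕ) : ℝ) - ((z.1 : Fin (K + 1)) : ℕ)| ≤ 1)
    (hmove : ∀ z, (κ z).real {y | ((y.1 : Fin (K + 1)) : ℕ) ≠ ((z.1 : Fin (K + 1)) : ℕ)} ≤ ptSwapRatio X β K z)
    (hs : Summable fun t => autocov κ (ptTaggedTarget X μ β K)
        (fun z => (((z.1 : Fin (K + 1)) : ℕ) : ℝ) - K / 2) (t + 1) /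
      autocov κ (ptTaggedTarget X μ β K) (fun z => (((z.1 : Fin (K + 1)) : ℕ) : ℝ) - K / 2) 0)
    (hρ : autocov κ (ptTaggedTarget X μ β K) (fun z => (((z.1 : Fin (K + 1)) : ℕ) : ℝ) - K / 2) 1 /
      autocov κ (ptTaggedTarget X μ β K) (fun z => (((z.1 : Fin (K + 1)) : ℕ) : ℝ) - K / 2) 0 < 1) :
    K * (K + 2) / (6 * (2 / (K + 1) * ∑ j : Fin K, swapAcc X μ (β (j : ℕ)) (β ((j : ℕ) + 1)))) - 1 / 2 ≤
      tauInt (fun t => autocov κ (ptTaggedTarget X μ β K) (fun z => (((z.1 : Fin (K + 1)) : ℕ) : ℝ) - K / 2) t /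
        autocov κ (ptTaggedTarget X μ β K) (fun z => (((z.1 : Fin (K + 1)) : ℕ) : ℝ) - K / 2) 0) := by
  haveI := isProbabilityMeasure_ptTaggedTarget (μ := μ) (β := β) (K := K) hXm hXb
  have h := level_tauInt_ge (lev := fun z : Fin (K + 1) × (Fin (K + 1) → Ω) => ((z.1 : Fin (K + 1)) : ℕ))
    hrev hinv measurable_ptLevel (fun z => Nat.le_of_lt_succ z.1.isLt) hK
    (fun k hk => ptTaggedTarget_real_level hXm hXb k hk) hnn (measurable_ptSwapRatio hXm) (R := 2 * K)
    ptSwapRatio_nonneg ptSwapRatio_le hmove hs hρ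
  rwa [pt_moveRate_eq hXm hXb] at h

/-- **REVERSIBLE REPLICA EXCHANGE, REPLICA-NUMBER-FREE**: uniform ladder from `a` to `b > a`, variance floor
`0 < m ≤ Var_{μ_u}(X)` on `[a, b]`: `e·m·(b−a)²/48 − ½ ≤ τ_int(tag level)` for every `K ≥ 1`. [ours] -/
theorem pt_level_tauInt_ge_kfree (hXm : Measurable X) (hXb : ∃ C, ∀ x, |X x| ≤ C) {a b m : ℝ} (hab : a < b)
    (hm0 : 0 < m) (hm : ∀ u ∈ Icc a b, m ≤ variance X (μ.tilted fun x => u * X x)) (hK : 1 ≤ K)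
    (κ : Kernel (Fin (K + 1) × (Fin (K + 1) → Ω)) (Fin (K + 1) × (Fin (K + 1) → Ω))) [IsMarkovKernel κ]
    (hrev : Kernel.IsReversible κ (ptTaggedTarget X μ (fun k => a + k * ((b - a) / K)) K))
    (hinv : Kernel.Invariant κ (ptTaggedTarget X μ (fun k => a + k * ((b - a) / K)) K))
    (hnn : ∀ z, ∀ᵐ y ∂(κ z), |(((y.1 : Fin (K + 1)) : ℕ) : ℝ) - ((z.1 : Fin (K + 1)) : ℕ)| ≤ 1)
    (hmove : ∀ z, (κ z).real {y | ((y.1 : Fin (K + 1)) : ℕ) ≠ ((z.1 : Fin (K + 1)) : ℕ)} ≤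
      ptSwapRatio X (fun k => a + k * ((b - a) / K)) K z)
    (hs : Summable fun t => autocov κ (ptTaggedTarget X μ (fun k => a + k * ((b - a) / K)) K)
        (fun z => (((z.1 : Fin (K + 1)) : ℕ) : ℝ) - K / 2) (t + 1) /
      autocov κ (ptTaggedTarget X μ (fun k => a + k * ((b - a) / K)) K) (fun z => (((z.1 : Fin (K + 1)) : ℕ) : ℝ) - K / 2) 0)
    (hρ : autocov κ (ptTaggedTarget X μ (fun k => a + k * ((b - a) / K)) K) (fun z => (((z.1 : Fin (K + 1)) : ℕ) : ℝ) - K / 2) 1 /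
      autocov κ (ptTaggedTarget X μ (fun k => a + k * ((b - a) / K)) K) (fun z => (((z.1 : Fin (K + 1)) : ℕ) : ℝ) - K / 2) 0 < 1) :
    Real.exp 1 * m * (b - a) ^ 2 / 48 - 1 / 2 ≤
      tauInt (fun t => autocov κ (ptTaggedTarget X μ (fun k => a + k * ((b - a) / K)) K)
          (fun z => (((z.1 : Fin (K + 1)) : ℕ) : ℝ) - K / 2) t /
        autocov κ (ptTaggedTarget X μ (fun k => a + k * ((b - a) / K)) K) (fun z => (((z.1 : Fin (K + 1)) : ℕ) : ℝ) - K / 2) 0) := by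
  haveI := isProbabilityMeasure_ptTaggedTarget (μ := μ) (β := fun k => a + k * ((b - a) / K)) (K := K) hXm hXb
  obtain ⟨e0, e1⟩ := level_centred_lagOne_ge (lev := fun z : Fin (K + 1) × (Fin (K + 1) → Ω) => ((z.1 : Fin (K + 1)) : ℕ))
    hinv measurable_ptLevel (fun z => Nat.le_of_lt_succ z.1.isLt) (fun k hk => ptTaggedTarget_real_level hXm hXb k hk)
    hnn (measurable_ptSwapRatio hXm) (R := 2 * K) ptSwapRatio_nonneg ptSwapRatio_le hmove
  have hrateEq := pt_moveRate_eq (μ := μ) (β := fun k => a + k * ((b - a) / K)) (K := K) hXm hXb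
  have hlad := pt_moveRate_le_ladder (μ := μ) hXm hXb hab.le hK hm
  have hKr : (1 : ℝ) ≤ K := by exact_mod_cast hK
  have hKpos : (0 : ℝ) < K * (K + 2) := by positivity
  have hba : 0 < (b - a) ^ 2 := by nlinarith
  have hA : 0 < m * (b - a) ^ 2 / 4 := by positivity
  have hkfree := ladder_rate_kfree hA hKr
  have eA : -(m * (b - a) ^ 2 / 4 / (K : ℝ) ^ 2) = -(m * (b - a) ^ 2 / (4 * K ^ 2)) := by rw [div_div]
  rw [eA] at hkfree
  have hsum : (∑ j : Fin K, swapAcc X μ ((fun k : ℕ => a + k * ((b - a) / K)) (j : ℕ))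
      ((fun k : ℕ => a + k * ((b - a) / K)) ((j : ℕ) + 1))) =
      ∑ j : Fin K, swapAcc X μ (a + (j : ℕ) * ((b - a) / K)) (a + (((j : ℕ) + 1 : ℕ) : ℝ) * ((b - a) / K)) := by
    refine Finset.sum_congr rfl fun j _ => ?_
    simp only [Nat.cast_add, Nat.cast_one]
  rw [hsum] at hrateEq
  have hIle : ∫ z, ptSwapRatio X (fun k => a + k * ((b - a) / K)) K z
      ∂(ptTaggedTarget X μ (fun k => a + k * ((b - a) / K)) K) ≤
      2 * K / (K + 1) * Real.exp (-(m * (b - a) ^ 2 / (4 * K ^ 2))) := by rw [hrateEq]; exact hlad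
  have hI : 6 * (∫ z, ptSwapRatio X (fun k => a + k * ((b - a) / K)) K z
      ∂(ptTaggedTarget X μ (fun k => a + k * ((b - a) / K)) K)) / (K * (K + 2)) ≤
      48 / (Real.exp 1 * m * (b - a) ^ 2) := by
    have e2 : 12 / (Real.exp 1 * (m * (b - a) ^ 2 / 4)) = 48 / (Real.exp 1 * m * (b - a) ^ 2) := by field_simp; ring
    calc 6 * (∫ z, ptSwapRatio X (fun k => a + k * ((b - a) / K)) K z
          ∂(ptTaggedTarget X μ (fun k => a + k * ((b - a) / K)) K)) / (K * (K + 2))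
        ≤ 6 * (2 * K / (K + 1) * Real.exp (-(m * (b - a) ^ 2 / (4 * K ^ 2)))) / (K * (K + 2)) := by gcongr
      _ = 12 * Real.exp (-(m * (b - a) ^ 2 / (4 * K ^ 2))) / ((K + 1) * (K + 2)) := by field_simp; ring
      _ ≤ 48 / (Real.exp 1 * m * (b - a) ^ 2) := by rw [← e2]; exact hkfree
  have hε : 1 - 48 / (Real.exp 1 * m * (b - a) ^ 2) ≤
      autocov κ (ptTaggedTarget X μ (fun k => a + k * ((b - a) / K)) K) (fun z => (((z.1 : Fin (K + 1)) : ℕ) : ℝ) - K / 2) 1 /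
      autocov κ (ptTaggedTarget X μ (fun k => a + k * ((b - a) / K)) K) (fun z => (((z.1 : Fin (K + 1)) : ℕ) : ℝ) - K / 2) 0 := by
    rw [e0, le_div_iff₀ (by positivity)]
    have e3 : (1 - 48 / (Real.exp 1 * m * (b - a) ^ 2)) * (↑K * (↑K + 2) / 12) =
        ↑K * (↑K + 2) / 12 - (48 / (Real.exp 1 * m * (b - a) ^ 2)) * (↑K * (↑K + 2)) / 12 := by ring
    rw [e3]
    have h4 : 1 / 2 * (∫ z, ptSwapRatio X (fun k => a + k * ((b - a) / K)) K z
        ∂(ptTaggedTarget X μ (fun k => a + k * ((b - a) / K)) K)) ≤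
        (48 / (Real.exp 1 * m * (b - a) ^ 2)) * (↑K * (↑K + 2)) / 12 := by
      have := (div_le_iff₀ hKpos).1 hI
      linarith
    linarith
  obtain ⟨hfm, hfb⟩ := centredLevel_measurable_abs_le (lev := fun z : Fin (K + 1) × (Fin (K + 1) → Ω) =>
    ((z.1 : Fin (K + 1)) : ℕ)) measurable_ptLevel (fun z => Nat.le_of_lt_succ z.1.isLt)
  have h := tauInt_ge_inv_of_lagOne_ge hrev hfm hfb hs hρ hε
  rwa [one_div_div] at h

end PT

end Summit.Ventures.LatticeQCDFlow.Scaling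

end
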